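import Mathlib
import HarnessLib
import Literature.Algebra.Polynomial.ModularEEA

/-!
# ValiantsHypothesis / LacunarySymmetroid — crux `MatrixDescartes` (stmt-ValiantsHypothesis-18050, V1),
# line «osculation-law»: UNIFORM columns, part 1 — the gcd of a SPECIALISED pair of bivariate polynomials
# as a quotient of two fixed polynomials (subresultant packaging of MCA §6.10–§6.11)

For `f, g ∈ ℝ[t][b]` (outer variable `b`, coefficients polynomials in `t`) of `b`-degrees `n ≥ m`, let `k ≤ m` be the
least index with `σ_k(f,g) ≠ 0` (subresultants over the coefficient ring `ℝ[t]`).  At every abscissa `t` where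
`lc_b f`, `lc_b g` and `σ_k` do not vanish, the monic gcd of the specialised pair `(f(t,·), g(t,·))` is
`N(t,·)/D(t)` for ONE pair `(N, D)` independent of `t` (`N = σ_k·r` = `sigmaR f g k`, `D = σ_k` when `k < m`;
`N = g`, `D = lc_b g` when `k = m`): it is monic, divides both specialisations, and vanishes at every common root.
This is the tree's modular EEA (`Literature.Algebra.Polynomial.ModularEEA.monic_row_map_eq`, Theorem 6.55 of
von zur Gathen–Gerhard, with `φ = evalRingHom t`) plus the remark that a remainder of degree `< k` would put a
degree `< k` into the degree sequence of the specialised pair, contradicting `σ_j ≡ 0` for `j < k`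
(`inDegSeq_map_iff`, Theorem 6.55 (ii)) — so the degree-`k` row is the LAST row, hence the gcd.

Honest framing: helper algebra toward a UNIFORM Descartes ceiling for the osculation-law columns of an UNREGISTERED V1
law line; `OsculationLaw` (all `m`), `PeelInequality`, `MatrixDescartes`, Conjecture B and `VP ≠ VNP` are OPEN / NOT
proved.  No definitions, no named facts; Mathlib + `Literature.Algebra.Polynomial.ModularEEA` only.
-/

-- `Summit.ValiantsHypothesis.ValiantsHypothesis.…` is the tree's mandated single-conjunct layout (Sub = Summit).
set_option linter.dupNamespace false

noncomputable section

namespace Summit.ValiantsHypothesis.ValiantsHypothesis.Theorems.LacunarySymmetroidMatrixDescartes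

namespace OsculationUniform

open Polynomial
open Literature.Algebra.Polynomial Literature.Algebra.Polynomial.Subresultant Literature.Algebra.Polynomial.ModularEEA

/-! ### The last row of the monic EEA divides `f` and `g` -/

/-- If row `i + 1` of the monic EEA vanishes, row `i` divides every earlier row, in particular `f` and `g`.
[folklore] -/
theorem mR_dvd_of_succ_eq_zero {F : Type*} [Field F] (f g : F[X]) (i : ℕ) (h : mR f g (i + 1) = 0) :
    mR f g i ∣ f ∧ mR f g i ∣ g := by
  -- `mR i ∣ mR j` and `mR i ∣ mR (j+1)` whenever `j + d = i`, by induction on `d`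
  have key : ∀ d j : ℕ, j + d = i → mR f g i ∣ mR f g j ∧ mR f g i ∣ mR f g (j + 1) := by
    intro d
    induction d with
    | zero =>
      intro j hj
      rw [Nat.add_zero] at hj
      subst hj
      exact ⟨dvd_rfl, by rw [h]; exact dvd_zero _⟩
    | succ d ih =>
      intro j hj
      obtain ⟨h1, h2⟩ := ih (j + 1) (by omega)
      refine ⟨?_, h1⟩
      -- `mR j = mR (j+1) * q + (mR j % mR (j+1))` and the remainder is a unit multiple of `mR (j+2)`
      have hrem : mR f g j % mR f g (j + 1) = C (lu (mR f g j % mR f g (j + 1))) * mR f g (j + 2) := by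
        rw [mR_succ_succ, C_lu_mul_normalForm]
      have hdiv := EuclideanDomain.div_add_mod (mR f g j) (mR f g (j + 1))
      rw [← hdiv, hrem]
      exact dvd_add (dvd_mul_of_dvd_left h1 _) (dvd_mul_of_dvd_right h2 _)
  obtain ⟨h0, h1⟩ := key i 0 (by omega)
  rw [Nat.zero_add, mR_one] at h1
  rw [mR_zero] at h0
  exact ⟨h0.trans ⟨C (lu f), by rw [mul_comm, C_lu_mul_normalForm]⟩,
    h1.trans ⟨C (lu g), by rw [mul_comm, C_lu_mul_normalForm]⟩⟩

/-- A common root of `f` and `g` is a root of every row of the monic EEA (`sᵢ f + tᵢ g = rᵢ`). [folklore] -/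
theorem isRoot_mR_of_isRoot {F : Type*} [Field F] (f g : F[X]) (i : ℕ) {β : F} (hf : f.IsRoot β)
    (hg : g.IsRoot β) : (mR f g i).IsRoot β := by
  rw [IsRoot, ← mS_mul_add_mT_mul, eval_add, eval_mul, eval_mul, hf.eq_zero, hg.eq_zero, mul_zero, mul_zero,
    add_zero]

/-- The degrees of the monic EEA rows decrease strictly after row `1`. [folklore] -/
theorem natDegree_mR_succ_lt {F : Type*} [Field F] (f g : F[X]) {i : ℕ} (hi : 1 ≤ i) (hne : mR f g i ≠ 0)
    (hne' : mR f g (i + 1) ≠ 0) : (mR f g (i + 1)).natDegree < (mR f g i).natDegree := by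
  obtain ⟨j, rfl⟩ : ∃ j, i = j + 1 := ⟨i - 1, by omega⟩
  apply natDegree_lt_natDegree hne'
  rw [show j + 1 + 1 = j + 2 from rfl, mR_succ_succ, degree_normalForm]
  exact EuclideanDomain.mod_lt _ hne

/-- A nonzero row of degree `k'` puts `k'` into the degree sequence. [folklore] -/
theorem inDegSeq_of_rows {F : Type*} [Field F] (f g : F[X]) {i k' : ℕ} (hrows : ∀ j ≤ i, mR f g j ≠ 0)
    (hk' : (mR f g i).natDegree = k') : InDegSeq f g k' :=
  (inDegSeq_iff_mR f g).2 ⟨i, hrows, hk'⟩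

/-! ### The specialised gcd as `N(t,·)/D(t)` -/

/-- **The gcd row under evaluation.**  `f, g ∈ ℝ[X][X]` (outer variable `b`, coefficients in `ℝ[t]`), `b`-degrees
`n ≥ m`, `k ≤ m` the least index with `σ_k(f,g) ≠ 0` below it (`σ_j = 0` for `j < k`).  There are `N ∈ ℝ[X][X]` and
`D ∈ ℝ[X]` such that at every `t` with `lc f (t) ≠ 0`, `lc g (t) ≠ 0`, `σ_k(t) ≠ 0`: `D(t) ≠ 0`, and
`ρ_t := D(t)⁻¹ · N(t,·)` is monic, divides `f(t,·)` and `g(t,·)`, and vanishes at every common root of the two.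
[cite: GathenGerhard1999, Theorem 6.55; Corollary 6.49] -/
theorem gcd_row (f g : ℝ[X][X]) {n m k : ℕ} (hn : f.natDegree = n) (hm : g.natDegree = m) (hmn : m ≤ n)
    (hkm : k ≤ m) (hlow : ∀ j < k, subresultant f g j = 0) :
    ∃ (N : ℝ[X][X]) (D : ℝ[X]), ∀ t : ℝ, (f.leadingCoeff).eval t ≠ 0 → (g.leadingCoeff).eval t ≠ 0 →
      (subresultant f g k).eval t ≠ 0 →
      D.eval t ≠ 0 ∧ (C (D.eval t)⁻¹ * N.map (evalRingHom t)).Monic ∧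
        C (D.eval t)⁻¹ * N.map (evalRingHom t) ∣ f.map (evalRingHom t) ∧
        C (D.eval t)⁻¹ * N.map (evalRingHom t) ∣ g.map (evalRingHom t) ∧
        ∀ β : ℝ, (f.map (evalRingHom t)).IsRoot β → (g.map (evalRingHom t)).IsRoot β →
          (C (D.eval t)⁻¹ * N.map (evalRingHom t)).IsRoot β := by
  rcases Nat.lt_or_ge k m with hlt | hge
  · -- `k < m`: the row of degree `k` of Theorem 6.55 (iii), which is the last row
    refine ⟨sigmaR f g k, subresultant f g k, fun t hlf hlg hσ => ?_⟩
    set φ : ℝ[X] →+* ℝ := evalRingHom t with hφ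
    have hlf' : φ f.leadingCoeff ≠ 0 := hlf
    have hlg' : φ g.leadingCoeff ≠ 0 := hlg
    have hσ' : φ (subresultant f g k) ≠ 0 := hσ
    obtain ⟨i, hrows, hdeg, hR, -, -⟩ := monic_row_map_eq φ hn hm hmn hlf' hlg' (by omega) hkm hσ'
    have hρ : C ((subresultant f g k).eval t)⁻¹ * (sigmaR f g k).map (evalRingHom t) = mR (f.map φ) (g.map φ) i := by
      rw [hR]; rfl
    rw [hρ]
    have hi0 : mR (f.map φ) (g.map φ) i ≠ 0 := hrows i le_rfl
    -- the next row vanishes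
    have hnext : mR (f.map φ) (g.map φ) (i + 1) = 0 := by
      by_contra hne
      have hnf : (f.map φ).natDegree = n := by rw [natDegree_map_of_leadingCoeff_ne_zero φ hlf', hn]
      have hi1 : 1 ≤ i := by
        by_contra h0
        have : i = 0 := by omega
        subst this
        rw [mR_zero, natDegree_normalForm, hnf] at hdeg
        omega
      have hlt' := natDegree_mR_succ_lt (f.map φ) (g.map φ) hi1 hi0 hne
      rw [hdeg] at hlt'
      have hin : InDegSeq (f.map φ) (g.map φ) (mR (f.map φ) (g.map φ) (i + 1)).natDegree :=
        inDegSeq_of_rows _ _ (fun j hj => by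
          rcases Nat.lt_or_ge j (i + 1) with h | h
          · exact hrows j (by omega)
          · have : j = i + 1 := by omega
            subst this; exact hne) rfl
      have hσ'' := (inDegSeq_map_iff φ hn hm hmn hlf' hlg' (by omega)).1 hin
      exact hσ'' (by rw [hlow _ hlt', map_zero])
    obtain ⟨hdf, hdg⟩ := mR_dvd_of_succ_eq_zero (f.map φ) (g.map φ) i hnext
    exact ⟨hσ, monic_mR _ _ hi0, hdf, hdg, fun β hfβ hgβ => isRoot_mR_of_isRoot _ _ i hfβ hgβ⟩
  · -- `k = m`: the gcd is `g(t,·)` itself (row `1`), because row `2` would have degree `< m`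
    have hkm' : k = m := le_antisymm hkm hge
    refine ⟨g, g.leadingCoeff, fun t hlf hlg _ => ?_⟩
    set φ : ℝ[X] →+* ℝ := evalRingHom t with hφ
    have hlf' : φ f.leadingCoeff ≠ 0 := hlf
    have hlg' : φ g.leadingCoeff ≠ 0 := hlg
    have hg0 : g.map φ ≠ 0 := fun h0 => hlg' (by
      rw [← coeff_natDegree, ← coeff_map, h0, coeff_zero])
    have hf0 : f.map φ ≠ 0 := fun h0 => hlf' (by
      rw [← coeff_natDegree, ← coeff_map, h0, coeff_zero])
    have hmg : (g.map φ).natDegree = m := by rw [natDegree_map_of_leadingCoeff_ne_zero φ hlg', hm]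
    have hlu : lu (g.map φ) = g.leadingCoeff.eval t := by
      rw [lu_of_ne_zero hg0, leadingCoeff_map_of_leadingCoeff_ne_zero φ hlg']; rfl
    have hρ : C (g.leadingCoeff.eval t)⁻¹ * g.map (evalRingHom t) = mR (f.map φ) (g.map φ) 1 := by
      rw [mR_one, normalForm, hlu]
    rw [hρ]
    have h10 : mR (f.map φ) (g.map φ) 1 ≠ 0 := by rw [mR_one, Ne, normalForm_eq_zero_iff]; exact hg0
    have hnext : mR (f.map φ) (g.map φ) 2 = 0 := by
      by_contra hne
      have hlt' : (mR (f.map φ) (g.map φ) 2).natDegree < (mR (f.map φ) (g.map φ) 1).natDegree :=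
        natDegree_mR_succ_lt (f.map φ) (g.map φ) le_rfl h10 hne
      rw [mR_one, natDegree_normalForm, hmg] at hlt'
      have hin : InDegSeq (f.map φ) (g.map φ) (mR (f.map φ) (g.map φ) 2).natDegree :=
        inDegSeq_of_rows _ _ (fun j hj => by
          rcases Nat.lt_or_ge j 1 with h | h
          · have : j = 0 := by omega
            subst this
            rw [mR_zero, Ne, normalForm_eq_zero_iff]; exact hf0
          · rcases Nat.lt_or_ge j 2 with h' | h'
            · have : j = 1 := by omega
              subst this; exact h10
            · have : j = 2 := by omega
              subst this; exact hne) rfl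
      have hσ'' := (inDegSeq_map_iff φ hn hm hmn hlf' hlg' (by omega)).1 hin
      exact hσ'' (by rw [hlow _ (by omega), map_zero])
    obtain ⟨hdf, hdg⟩ := mR_dvd_of_succ_eq_zero (f.map φ) (g.map φ) 1 hnext
    exact ⟨hlg, monic_mR _ _ h10, hdf, hdg, fun β hfβ hgβ => isRoot_mR_of_isRoot _ _ 1 hfβ hgβ⟩

end OsculationUniform

end Summit.ValiantsHypothesis.ValiantsHypothesis.Theorems.LacunarySymmetroidMatrixDescartes
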